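import Literature.MathematicalPhysics.KineticTheory.TrigPoly
import Mathlib.Data.Nat.Dist
import Mathlib.Logic.Function.DependsOn
import Mathlib.LinearAlgebra.Pi
import HarnessLib

/-!
# The Poisson bracket of two symbolic trigonometric polynomials

`Literature/MathematicalPhysics/KineticTheory/` — continuation of `TrigPoly.lean` (the symbolic
class `𝒮(Ω)` of W. De Roeck, F. Huveneers, CPAM 68 (2015), arXiv:1305.5127, §3.1): the bracket
`L_g f = {g, f}` of two trigonometric polynomials is again one, computed termwise by the
product-to-sum formulas. For terms `t = a cos θ + b sin θ` (`θ = k·q`) and `t' = a' cos θ' + b' sin θ'`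
(`θ' = k'·q`),
`{t, t'} = (b' cos θ' - a' sin θ')(A cos θ + B sin θ) - (b cos θ - a sin θ)(A' cos θ' + B' sin θ')`
with the directional derivatives `A = (k'·∇_ω) a`, `B = (k'·∇_ω) b`, `A' = (k·∇_ω) a'`,
`B' = (k·∇_ω) b'`, which is a combination of `cos(θ ± θ')`, `sin(θ ± θ')`: two terms with modes
`k + k'` and `k - k'` (`TrigTerm.bracket`, `TrigTerm.poisson_ev_ev`).

Locality ("`(L_g f)_x = L_g f_x`", "`r(L_g f) ≤ 2 r(g) + r(f)`", §3.3): a term SUPPORTED WITHIN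
radius `r` of its anchor (`TrigTerm.SuppWithin`: the mode vanishes outside the ball `siteBall pos r`
and the coefficients `DependsOn` it — Mathlib's `DependsOn`) has zero bracket with any term supported within `r'` of an
anchor at distance `> r + r'` (`poisson_ev_ev_eq_zero_of_far`); the polynomial bracket
`TrigPoly.bracket r r'` keeps only the close pairs, and **`TrigPoly.poisson_ev_ev`** proves
`{ev F, ev G} = ev (bracket r r' F G)` under these support hypotheses. No named facts.
-/

noncomputable section

open Function Set Finset
open scoped ContDiff BigOperators

namespace Literature.MathematicalPhysics.KineticTheory.HeatConduction

variable {m : ℕ}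

/-! ### Linear-algebra helpers -/

/-- `modeVec k = (x ↦ k_x)` as an equation between functions. [folklore] -/
theorem modeVec_eq (k : Fin m → ℤ) : modeVec k = fun x => (k x : ℝ) := rfl

/-- `∑_x c_x L(e_x) = L(c)` for a linear form `L` on `ℝ^m` (Mathlib's `LinearMap.pi_apply_eq_sum_univ`).
[folklore] -/
theorem sum_mul_clm_single (L : (Fin m → ℝ) →L[ℝ] ℝ) (c : Fin m → ℝ) :
    ∑ x : Fin m, c x * L (Pi.single x 1) = L c := by
  have h := (L : (Fin m → ℝ) →ₗ[ℝ] ℝ).pi_apply_eq_sum_univ c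
  rw [ContinuousLinearMap.coe_coe] at h
  rw [h]
  refine sum_congr rfl fun x _ => ?_
  rw [smul_eq_mul]
  congr 2
  funext j
  simp [Pi.single_apply, eq_comm]

/-- The sites within distance `r` of `x₀` (free boundary conditions: `|x - x₀|` on `Fin m`).
[cite: DeRoeckHuveneers2015, §3.1 eq. (3.2)] -/
def siteBall (x₀ : Fin m) (r : ℕ) : Set (Fin m) := {x | Nat.dist x₀.val x.val ≤ r}

/-- Membership in a site ball. [folklore] -/
@[simp] theorem mem_siteBall {x₀ x : Fin m} {r : ℕ} : x ∈ siteBall x₀ r ↔ Nat.dist x₀.val x.val ≤ r := Iff.rfl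

namespace TrigTerm

/-! ### The bracket of two terms -/

/-- The directional derivative `(k·∇_ω) c` of a coefficient family along the mode `k`. [folklore] -/
def dirDeriv (k : Fin m → ℤ) (c : ℝ → (Fin m → ℝ) → ℝ) (δ : ℝ) (w : Fin m → ℝ) : ℝ :=
  fderiv ℝ (c δ) w (modeVec k)

/-- **The bracket of two terms** `{t, t'}`, as the two terms with modes `k + k'` and `k - k'` given by
the product-to-sum formulas (anchored at the anchor of the second argument, "`(L_g f)_x = L_g f_x`").
[cite: DeRoeckHuveneers2015, §3.3 (proof of (3.11))] -/
def bracket (t t' : TrigTerm m) : TrigPoly m :=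
  let A := dirDeriv t'.mode t.cosCoeff
  let B := dirDeriv t'.mode t.sinCoeff
  let A' := dirDeriv t.mode t'.cosCoeff
  let B' := dirDeriv t.mode t'.sinCoeff
  [ { pos := t'.pos, mode := t.mode + t'.mode
      cosCoeff := fun δ w => (A δ w * t'.sinCoeff δ w + B δ w * t'.cosCoeff δ w -
        t.cosCoeff δ w * B' δ w - t.sinCoeff δ w * A' δ w) / 2
      sinCoeff := fun δ w => (-(A δ w * t'.cosCoeff δ w) + B δ w * t'.sinCoeff δ w +
        t.cosCoeff δ w * A' δ w - t.sinCoeff δ w * B' δ w) / 2 },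
    { pos := t'.pos, mode := t.mode - t'.mode
      cosCoeff := fun δ w => (A δ w * t'.sinCoeff δ w - B δ w * t'.cosCoeff δ w +
        t.cosCoeff δ w * B' δ w - t.sinCoeff δ w * A' δ w) / 2
      sinCoeff := fun δ w => (A δ w * t'.cosCoeff δ w + B δ w * t'.sinCoeff δ w +
        t.cosCoeff δ w * A' δ w + t.sinCoeff δ w * B' δ w) / 2 } ]

/-- The closed form of the bracket of two term evaluations (differentiable coefficients):
`{t, t'} = (b' cos θ' - a' sin θ')(A cos θ + B sin θ) - (b cos θ - a sin θ)(A' cos θ' + B' sin θ')`.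
[folklore] -/
theorem poisson_ev_ev_eq (t t' : TrigTerm m) {δ : ℝ} (ha : Differentiable ℝ (t.cosCoeff δ))
    (hb : Differentiable ℝ (t.sinCoeff δ)) (ha' : Differentiable ℝ (t'.cosCoeff δ))
    (hb' : Differentiable ℝ (t'.sinCoeff δ)) (z : PhaseSpace m) :
    poisson (t.ev δ) (t'.ev δ) z =
      (t'.sinCoeff δ z.2 * Real.cos (modePhase t'.mode z.1) - t'.cosCoeff δ z.2 * Real.sin (modePhase t'.mode z.1)) *
          (dirDeriv t'.mode t.cosCoeff δ z.2 * Real.cos (modePhase t.mode z.1) +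
            dirDeriv t'.mode t.sinCoeff δ z.2 * Real.sin (modePhase t.mode z.1)) -
        (t.sinCoeff δ z.2 * Real.cos (modePhase t.mode z.1) - t.cosCoeff δ z.2 * Real.sin (modePhase t.mode z.1)) *
          (dirDeriv t.mode t'.cosCoeff δ z.2 * Real.cos (modePhase t'.mode z.1) +
            dirDeriv t.mode t'.sinCoeff δ z.2 * Real.sin (modePhase t'.mode z.1)) := by
  unfold poisson
  simp only [partialP_ev t ha hb, partialQ_ev, partialP_ev t' ha' hb']
  -- name the trigonometric factors
  set c := Real.cos (modePhase t.mode z.1)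
  set s := Real.sin (modePhase t.mode z.1)
  set c' := Real.cos (modePhase t'.mode z.1)
  set s' := Real.sin (modePhase t'.mode z.1)
  have e : ∀ x : Fin m,
      (fderiv ℝ (t.cosCoeff δ) z.2 (Pi.single x 1) * c + fderiv ℝ (t.sinCoeff δ) z.2 (Pi.single x 1) * s) *
          ((t'.mode x : ℝ) * (t'.sinCoeff δ z.2 * c' - t'.cosCoeff δ z.2 * s')) -
        (t.mode x : ℝ) * (t.sinCoeff δ z.2 * c - t.cosCoeff δ z.2 * s) *
          (fderiv ℝ (t'.cosCoeff δ) z.2 (Pi.single x 1) * c' + fderiv ℝ (t'.sinCoeff δ) z.2 (Pi.single x 1) * s') =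
      (t'.sinCoeff δ z.2 * c' - t'.cosCoeff δ z.2 * s') * c * ((t'.mode x : ℝ) * fderiv ℝ (t.cosCoeff δ) z.2 (Pi.single x 1)) +
      (t'.sinCoeff δ z.2 * c' - t'.cosCoeff δ z.2 * s') * s * ((t'.mode x : ℝ) * fderiv ℝ (t.sinCoeff δ) z.2 (Pi.single x 1)) -
      (t.sinCoeff δ z.2 * c - t.cosCoeff δ z.2 * s) * c' * ((t.mode x : ℝ) * fderiv ℝ (t'.cosCoeff δ) z.2 (Pi.single x 1)) -
      (t.sinCoeff δ z.2 * c - t.cosCoeff δ z.2 * s) * s' * ((t.mode x : ℝ) * fderiv ℝ (t'.sinCoeff δ) z.2 (Pi.single x 1)) := by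
    intro x; ring
  simp only [e, sum_add_distrib, sum_sub_distrib, ← mul_sum, sum_mul_clm_single]
  simp only [dirDeriv, modeVec_eq]
  ring

/-- **`{ev t, ev t'} = ev (bracket t t')`** (differentiable coefficients at scale `δ`): the
product-to-sum formulas. [cite: DeRoeckHuveneers2015, §3.3] -/
theorem poisson_ev_ev (t t' : TrigTerm m) {δ : ℝ} (ha : Differentiable ℝ (t.cosCoeff δ))
    (hb : Differentiable ℝ (t.sinCoeff δ)) (ha' : Differentiable ℝ (t'.cosCoeff δ))
    (hb' : Differentiable ℝ (t'.sinCoeff δ)) (z : PhaseSpace m) :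
    poisson (t.ev δ) (t'.ev δ) z = TrigPoly.ev (t.bracket t') δ z := by
  rw [poisson_ev_ev_eq t t' ha hb ha' hb' z]
  simp only [bracket, TrigPoly.ev_cons, TrigPoly.ev_nil, ev, modePhase_add, modePhase_sub, Real.cos_add,
    Real.sin_add, Real.cos_sub, Real.sin_sub]
  ring

/-! ### Locality: terms supported within a radius of their anchor -/

/-- **Support within radius `r`** of a term: its mode vanishes, and its coefficients do not depend
on the momenta (Mathlib's `DependsOn`), at the sites at distance `> r` from the anchor
("`∂f_x/∂q_y = ∂f_x/∂ω_y = 0` if `|x - y| > r(f)`"). [cite: DeRoeckHuveneers2015, §3.1 eq. (3.2)] -/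
def SuppWithin (t : TrigTerm m) (r : ℕ) : Prop :=
  (∀ x : Fin m, r < Nat.dist t.pos.val x.val → t.mode x = 0) ∧
    ∀ δ : ℝ, DependsOn (t.cosCoeff δ) (siteBall t.pos r) ∧ DependsOn (t.sinCoeff δ) (siteBall t.pos r)

/-- A coefficient that does not depend on `ω_x` has zero derivative in the direction `e_x`.
[folklore] -/
theorem fderiv_single_eq_zero_of_dependsOn {x₀ : Fin m} {r : ℕ} {g : (Fin m → ℝ) → ℝ}
    (hg : DependsOn g (siteBall x₀ r)) (hd : Differentiable ℝ g) {x : Fin m} (hx : r < Nat.dist x₀.val x.val)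
    (w : Fin m → ℝ) : fderiv ℝ g w (Pi.single x 1) = 0 := by
  have hconst : ∀ s : ℝ, g (w + s • (Pi.single x (1 : ℝ) : Fin m → ℝ)) = g w := by
    intro s
    refine hg fun y hy => ?_
    rw [mem_siteBall] at hy
    have hyx : y ≠ x := fun h => by rw [h] at hy; exact absurd hy (not_le.2 hx)
    simp [hyx]
  have hline : HasLineDerivAt ℝ g (fderiv ℝ g w (Pi.single x 1)) w (Pi.single x 1) :=
    (hd w).hasFDerivAt.hasLineDerivAt _
  have hzero : HasLineDerivAt ℝ g 0 w (Pi.single x 1) := by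
    have : HasDerivAt (fun s : ℝ => g (w + s • (Pi.single x (1 : ℝ) : Fin m → ℝ))) 0 0 := by
      simp only [hconst]; exact hasDerivAt_const 0 (g w)
    exact this
  exact hline.unique hzero

/-- **Far-apart local terms commute**: if `t` is supported within `r` of its anchor, `t'` within
`r'` of its, and the anchors are at distance `> r + r'`, then `{ev t, ev t'} = 0` ("the Poisson
bracket of two functions depending on variables indexed by points belonging to different,
non-intersecting, subsets of `ℤ_N`, vanishes", §5.4). [cite: DeRoeckHuveneers2015, §5.4 (after (5.13))] -/
theorem poisson_ev_ev_eq_zero_of_far (t t' : TrigTerm m) {r r' : ℕ} (ht : t.SuppWithin r)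
    (ht' : t'.SuppWithin r') (hfar : r + r' < Nat.dist t.pos.val t'.pos.val) {δ : ℝ}
    (ha : Differentiable ℝ (t.cosCoeff δ)) (hb : Differentiable ℝ (t.sinCoeff δ))
    (ha' : Differentiable ℝ (t'.cosCoeff δ)) (hb' : Differentiable ℝ (t'.sinCoeff δ)) (z : PhaseSpace m) :
    poisson (t.ev δ) (t'.ev δ) z = 0 := by
  unfold poisson
  refine sum_eq_zero fun x _ => ?_
  simp only [partialP_ev t ha hb, partialQ_ev, partialP_ev t' ha' hb']
  -- every site is far from one of the two anchors
  have hx : r < Nat.dist t.pos.val x.val ∨ r' < Nat.dist t'.pos.val x.val := by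
    by_contra h
    rw [not_or, not_lt, not_lt] at h
    have := Nat.dist.triangle_inequality t.pos.val x.val t'.pos.val
    rw [Nat.dist_comm x.val] at this
    omega
  rcases hx with hx | hx
  · rw [ht.1 x hx, fderiv_single_eq_zero_of_dependsOn (ht.2 δ).1 ha hx,
      fderiv_single_eq_zero_of_dependsOn (ht.2 δ).2 hb hx]
    simp
  · rw [ht'.1 x hx, fderiv_single_eq_zero_of_dependsOn (ht'.2 δ).1 ha' hx,
      fderiv_single_eq_zero_of_dependsOn (ht'.2 δ).2 hb' hx]
    simp

end TrigTerm

namespace TrigPoly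

/-- **The bracket of two trigonometric polynomials**, keeping only the pairs of terms whose anchors
are within distance `r + r'` (the others have zero bracket when the terms are supported within `r`,
`r'` of their anchors). [cite: DeRoeckHuveneers2015, §3.3 ("`(L_g f)_x = L_g f_x`")] -/
def bracket (r r' : ℕ) (F G : TrigPoly m) : TrigPoly m :=
  F.flatMap fun t => G.flatMap fun t' =>
    if Nat.dist t.pos.val t'.pos.val ≤ r + r' then t.bracket t' else []

/-- Hypothesis bundle: every term of `F` is supported within `r` of its anchor and has
differentiable coefficients at scale `δ`. [folklore] -/
def Admissible (F : TrigPoly m) (r : ℕ) (δ : ℝ) : Prop :=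
  ∀ t ∈ F, t.SuppWithin r ∧ Differentiable ℝ (t.cosCoeff δ) ∧ Differentiable ℝ (t.sinCoeff δ)

/-- Admissibility of a tail. [folklore] -/
theorem Admissible.tail {t : TrigTerm m} {F : TrigPoly m} {r : ℕ} {δ : ℝ} (h : Admissible (t :: F) r δ) :
    Admissible F r δ := fun s hs => h s (by simp [hs])

/-- Admissibility of the head. [folklore] -/
theorem Admissible.head {t : TrigTerm m} {F : TrigPoly m} {r : ℕ} {δ : ℝ} (h : Admissible (t :: F) r δ) :
    t.SuppWithin r ∧ Differentiable ℝ (t.cosCoeff δ) ∧ Differentiable ℝ (t.sinCoeff δ) := h t (by simp)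

/-- Admissible polynomials evaluate to differentiable functions. [folklore] -/
theorem Admissible.differentiable_ev {F : TrigPoly m} {r : ℕ} {δ : ℝ} (h : Admissible F r δ) :
    Differentiable ℝ (ev F δ) :=
  TrigPoly.differentiable_ev F fun t ht => (h t ht).2

/-- The bracket of one admissible term with an admissible polynomial. [folklore] -/
theorem poisson_ev_term_ev {t : TrigTerm m} {G : TrigPoly m} {r r' : ℕ} {δ : ℝ}
    (ht : t.SuppWithin r ∧ Differentiable ℝ (t.cosCoeff δ) ∧ Differentiable ℝ (t.sinCoeff δ))
    (hG : Admissible G r' δ) (z : PhaseSpace m) :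
    poisson (t.ev δ) (ev G δ) z =
      ev (G.flatMap fun t' => if Nat.dist t.pos.val t'.pos.val ≤ r + r' then t.bracket t' else []) δ z := by
  induction G with
  | nil =>
    simp only [List.flatMap_nil, ev_nil]
    exact poisson_const_right (t.ev δ) 0 z
  | cons t' G ih =>
    have ht' := hG.head
    have e : ev (t' :: G) δ = t'.ev δ + ev G δ := funext fun z => ev_cons t' G δ z
    rw [e, poisson_add_right _ (t'.differentiable_ev ht'.2.1 ht'.2.2) hG.tail.differentiable_ev, ih hG.tail,
      List.flatMap_cons, ev_append]
    congr 1
    by_cases hd : Nat.dist t.pos.val t'.pos.val ≤ r + r'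
    · rw [if_pos hd]
      exact TrigTerm.poisson_ev_ev t t' ht.2.1 ht.2.2 ht'.2.1 ht'.2.2 z
    · rw [if_neg hd, ev_nil]
      exact TrigTerm.poisson_ev_ev_eq_zero_of_far t t' ht.1 ht'.1 (not_le.1 hd) ht.2.1 ht.2.2 ht'.2.1 ht'.2.2 z

/-- **`{ev F, ev G} = ev (bracket r r' F G)`** for admissible `F` (radius `r`) and `G` (radius `r'`)
at scale `δ`. [cite: DeRoeckHuveneers2015, §3.3] -/
theorem poisson_ev_ev {F G : TrigPoly m} {r r' : ℕ} {δ : ℝ} (hF : Admissible F r δ) (hG : Admissible G r' δ)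
    (z : PhaseSpace m) : poisson (ev F δ) (ev G δ) z = ev (bracket r r' F G) δ z := by
  induction F with
  | nil =>
    simp only [bracket, List.flatMap_nil, ev_nil]
    exact poisson_const_left 0 (ev G δ) z
  | cons t F ih =>
    have ht := hF.head
    have e : ev (t :: F) δ = t.ev δ + ev F δ := funext fun z => ev_cons t F δ z
    rw [e, poisson_add_left (t.differentiable_ev ht.2.1 ht.2.2) hF.tail.differentiable_ev, ih hF.tail,
      poisson_ev_term_ev ht hG]
    simp only [bracket, List.flatMap_cons, ev_append]

/-- Anchors of the terms of a bracket are anchors of the second argument. [folklore] -/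
theorem pos_mem_bracket {r r' : ℕ} {F G : TrigPoly m} {s : TrigTerm m} (hs : s ∈ bracket r r' F G) :
    ∃ t ∈ F, ∃ t' ∈ G, Nat.dist t.pos.val t'.pos.val ≤ r + r' ∧ s.pos = t'.pos ∧
      (s.mode = t.mode + t'.mode ∨ s.mode = t.mode - t'.mode) := by
  simp only [bracket, List.mem_flatMap] at hs
  obtain ⟨t, htF, t', ht'G, hs⟩ := hs
  by_cases hd : Nat.dist t.pos.val t'.pos.val ≤ r + r'
  · rw [if_pos hd] at hs
    simp only [TrigTerm.bracket, List.mem_cons, List.mem_nil_iff, or_false] at hs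
    refine ⟨t, htF, t', ht'G, hd, ?_⟩
    rcases hs with rfl | rfl
    · exact ⟨rfl, Or.inl rfl⟩
    · exact ⟨rfl, Or.inr rfl⟩
  · rw [if_neg hd] at hs
    simp at hs

end TrigPoly

end Literature.MathematicalPhysics.KineticTheory.HeatConduction

end
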